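import Summits.CriticalPhenomena.PercolationContinuityZ3.Theorems.PercNearOneGluingNoHeavyLowerTailSahiThreeCopyTwoPointCertsK4

/-!
# Sahi's three-function conjecture — the up-sets of `{0,1}^5` as coded families, enumerated with a completeness proof

Infrastructure for the `k = 5` certificate theorem.  At `k = 4` the family of all up-closed code families is `upSetsC 4 =
univ.filter UpClosedC` (a filter of the `2^16` subsets of `Fin 16`, evaluated by the compiler); at `k = 5` the ambient power set
has `2^32` members and cannot be filtered.  Instead `upList5` GLUES nested pairs `(V₀ ⊆ V₁)` of up-closed families of `Fin 16`
codes along the top coordinate (`V = emb0 '' V₀ ∪ emb1 '' V₁`, `emb0 x = x`, `emb1 x = x + 16`), and ★ `mem_upList5` proves that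
EVERY up-closed family of `Fin 32` codes arises this way (its two sections are up-closed and nested).  The three order facts
about the embeddings are finite checks (`decide`). [this work]
-/

namespace Summit.CriticalPhenomena.PercolationContinuityZ3.Theorems.SahiThreeCopy

open Finset Function Literature.Combinatorics.Sahi2008

/-- Bottom-section embedding of codes: `x ↦ x` (top bit `0`). [this work] -/
def emb0 : Fin (2 ^ 4) ↪ Fin (2 ^ 5) := ⟨fun x => ⟨x, by have := x.isLt; simp at this ⊢; omega⟩, fun x y h => by
  simp only [Fin.mk.injEq] at h; exact Fin.ext h⟩

/-- Top-section embedding of codes: `x ↦ x + 16` (top bit `1`). [this work] -/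
def emb1 : Fin (2 ^ 4) ↪ Fin (2 ^ 5) := ⟨fun x => ⟨x + 16, by have := x.isLt; simp at this ⊢; omega⟩, fun x y h => by
  simp only [Fin.mk.injEq] at h; exact Fin.ext (by omega)⟩

/-- Gluing two sections into a family of `Fin 32` codes. [this work] -/
def glue5 (V₀ V₁ : Finset (Fin (2 ^ 4))) : Finset (Fin (2 ^ 5)) := V₀.map emb0 ∪ V₁.map emb1

/-- ★ The list of all up-sets of `{0,1}^5` (coded): glued nested pairs of up-sets of `{0,1}^4`. [this work] -/
def upList5 : Finset (Finset (Fin (2 ^ 5))) :=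
  ((upSetsC 4 ×ˢ upSetsC 4).filter fun p => p.1 ⊆ p.2).image fun p => glue5 p.1 p.2

/-- Every code of `{0,1}^5` is in exactly one section. [this work] -/
theorem emb_cases (z : Fin (2 ^ 5)) : (∃ x : Fin (2 ^ 4), emb0 x = z) ∨ (∃ x : Fin (2 ^ 4), emb1 x = z) := by
  by_cases h : (z : ℕ) < 16
  · left; refine ⟨⟨z, by simpa using h⟩, Fin.ext ?_⟩; simp [emb0]
  · right
    refine ⟨⟨(z : ℕ) - 16, ?_⟩, Fin.ext ?_⟩
    · have := z.isLt; simp at this ⊢; omega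
    · simp [emb1]; omega

/-- The bottom embedding is an order embedding (finite check). [this work] -/
theorem leC_emb0 : ∀ x y : Fin (2 ^ 4), LeC x y → LeC (emb0 x) (emb0 y) := by decide

/-- The top embedding is an order embedding (finite check). [this work] -/
theorem leC_emb1 : ∀ x y : Fin (2 ^ 4), LeC x y → LeC (emb1 x) (emb1 y) := by decide

/-- The bottom copy of a code lies below its top copy (finite check). [this work] -/
theorem leC_emb0_emb1 : ∀ x : Fin (2 ^ 4), LeC (emb0 x) (emb1 x) := by decide

/-- ★ **Completeness**: every up-closed family of `Fin 32` codes is in `upList5`. [this work] -/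
theorem mem_upList5 {V : Finset (Fin (2 ^ 5))} (hV : UpClosedC V) : V ∈ upList5 := by
  set V₀ : Finset (Fin (2 ^ 4)) := univ.filter fun x => emb0 x ∈ V with hV₀
  set V₁ : Finset (Fin (2 ^ 4)) := univ.filter fun x => emb1 x ∈ V with hV₁
  have h0 : UpClosedC V₀ := by
    intro x hx y hxy
    simp only [hV₀, mem_filter, mem_univ, true_and] at hx ⊢
    exact hV _ hx _ (leC_emb0 x y hxy)
  have h1 : UpClosedC V₁ := by
    intro x hx y hxy
    simp only [hV₁, mem_filter, mem_univ, true_and] at hx ⊢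
    exact hV _ hx _ (leC_emb1 x y hxy)
  have h01 : V₀ ⊆ V₁ := by
    intro x hx
    simp only [hV₀, hV₁, mem_filter, mem_univ, true_and] at hx ⊢
    exact hV _ hx _ (leC_emb0_emb1 x)
  have hglue : glue5 V₀ V₁ = V := by
    ext z
    simp only [glue5, mem_union, mem_map, hV₀, hV₁, mem_filter, mem_univ, true_and]
    constructor
    · rintro (⟨x, hx, rfl⟩ | ⟨x, hx, rfl⟩) <;> exact hx
    · intro hz
      rcases emb_cases z with ⟨x, rfl⟩ | ⟨x, rfl⟩
      · exact Or.inl ⟨x, hz, rfl⟩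
      · exact Or.inr ⟨x, hz, rfl⟩
  unfold upList5
  rw [mem_image]
  refine ⟨(V₀, V₁), ?_, hglue⟩
  simp only [mem_filter, mem_product, upSetsC, mem_univ, true_and]
  exact ⟨⟨h0, h1⟩, h01⟩

/- `upList5` is a large explicit family built with `Finset.image`; weak-head normalisation of a membership statement
`V ∈ upList5` would start evaluating the de-duplication.  It is only ever EVALUATED by the compiler (`native_decide`) and used
through `mem_upList5`, so we make it irreducible for the elaborator. -/
attribute [irreducible] upList5

end Summit.CriticalPhenomena.PercolationContinuityZ3.Theorems.SahiThreeCopy
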